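import Literature.AlgebraicGeometry.DuqueFrancoVillaflor2023.FakeLinearCycleQuadraticForm
import Literature.RingTheory.MvPolynomial.HomogeneousHilbertFunction
import Mathlib.RingTheory.MvPolynomial.EulerIdentity
import HarnessLib

/-!
# The degree-`r` piece of the quadratic fundamental form (Duque Franco–Villaflor 2025, Theorem 2.1): degrees of the lifts and of Maclean's form

J. Duque Franco, R. Villaflor Loyola, *Periods of join algebraic cycles*, Ann. Sc. Norm. Super. Pisa (2025) =
arXiv:2312.17222, §2.2 (text read: held text `paper:arxiv-2312.17222`, p. 6), **Theorem 2.1 (Maclean)**,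
verbatim: "The degree `r := d+(d−2)(n/2+1)` piece of the fundamental quadratic form is `q|_{Sym²(J^{F,λ}_d)}`
where `q : Sym²(J^{F,λ}) → R^F/⟨P_λ⟩` is the bilinear form given by
`q(G,H) = Σ_{i=0}^{n+1} (H ∂Q_i/∂x_i − R_i ∂G/∂x_i)` where `Q_i, R_i ∈ ℂ[x_0,…,x_{n+1}]` are such that
`G P_λ = Σ_{i=0}^{n+1} Q_i ∂F/∂x_i`, `H P_λ = Σ_{i=0}^{n+1} R_i ∂F/∂x_i`." Here (Definition 2.2)
`P_λ ∈ ℂ[x_0,…,x_{n+1}]_{(d−2)(n/2+1)}`, so `r = d + deg P_λ`.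

**What this file does** — the degree bookkeeping behind "the degree `r` piece", for the tree's polynomial
`macleanForm G H Q R = Σ_v (H ∂_v Q_v − R_v ∂_v G)` (`DuqueFrancoVillaflor2023/FakeLinearCycleQuadraticForm.lean`;
its well-definedness modulo `J^F` — independence of the lifts, symmetry, bilinearity — is
`DuqueFrancoVillaflor2025/JoinQuadraticFundamentalForm.lean`), over any field `K` and any finite set of
variables. PROVED, no hypotheses beyond the printed ones:
* `exists_isHomogeneous_lift` — in `K[x_σ]`, an element of `(g_v)_v` that is a form of degree `c + k`, all `g_v`
  forms of degree `k`, is `Σ_v Q_v g_v` with `Q_v` forms of degree `c` (replace any coefficients by their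
  degree-`c` components); `exists_isHomogeneous_lift_pderiv` — hence for forms `F, G, P` of degrees `d, a, p`
  with `G P ∈ J^F`, `G P = Σ_v Q_v ∂_v F` with `Q_v` forms of degree `m`, `m + (d − 1) = a + p`;
* `isHomogeneous_macleanForm` — for forms `G, H` of degrees `a, b` and homogeneous lifts `Q_v, R_v` of degrees
  `m, m'` with `b + m = c + 1 = m' + a`, `q(G,H)` is a form of degree `c` (whatever the lifts);
* `exists_lifts_isHomogeneous_macleanForm` — **Theorem 2.1's degree**: for `G, H ∈ (J^F : P)_e` there are
  homogeneous lifts of degree `m` (`m + (d − 1) = e + deg P`) and `q(G,H)` is a form of degree `e + m − 1`;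
  for `e = d` this is `m = deg P + 1` and degree `d + deg P = r` ("the degree `r := d + (d−2)(n/2+1)` piece",
  `deg P_λ = (d−2)(n/2+1)`).

NOT formalised here: the identification of `q` with the second fundamental form of the Hodge locus (IVHS),
which is the content of Maclean's theorem; only the algebra of the printed formula is.
certified instances and evidence bearing on the general Hodge conjecture; no claim.
-/

noncomputable section

open MvPolynomial Literature.RingTheory.MvPolynomial
open Literature.AlgebraicGeometry.DuqueFrancoVillaflor2023 (macleanForm)

namespace Literature.AlgebraicGeometry.DuqueFrancoVillaflor2025

variable {K : Type*} [Field K] {σ : Type*}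

/-! ## Homogeneous lifts -/

/-- **Homogeneous coefficients.** If `G ∈ (g_v)_v ⊆ K[x_σ]` is a form of degree `c + k` and every `g_v` is a
form of degree `k`, then `G = Σ_v Q_v g_v` with all `Q_v` forms of degree `c`: take the degree-`c` components
of arbitrary coefficients, `(Σ_v q_v g_v)_{c+k} = Σ_v (q_v)_c g_v` (the step "`Q_i, R_i` such that
`G P_λ = Σ Q_i ∂F/∂x_i`" may be taken homogeneous). [folklore; cf. [cite: DuqueFrancoVillaflor2025Join, Theorem 2.1]] -/
theorem exists_isHomogeneous_lift {ι : Type*} [Fintype ι] {g : ι → MvPolynomial σ K} {k : ℕ}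
    (hg : ∀ v, (g v).IsHomogeneous k) {G : MvPolynomial σ K} {c : ℕ} (hG : G.IsHomogeneous (c + k))
    (hmem : G ∈ Ideal.span (Set.range g)) :
    ∃ Q : ι → MvPolynomial σ K, (∀ v, (Q v).IsHomogeneous c) ∧ G = ∑ v, Q v * g v := by
  classical
  obtain ⟨q, hq⟩ := Ideal.mem_span_range_iff_exists_fun.mp hmem
  refine ⟨fun v => homogeneousComponent c (q v), fun v => homogeneousComponent_isHomogeneous c (q v), ?_⟩
  calc G = homogeneousComponent (c + k) G := (homogeneousComponent_eq_self hG).symm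
    _ = ∑ v, homogeneousComponent (c + k) (q v * g v) := by rw [← hq, map_sum]
    _ = ∑ v, homogeneousComponent c (q v) * g v := Finset.sum_congr rfl fun v _ => by
        rw [mul_comm (q v), homogeneousComponent_mul_add_of_isHomogeneous (hg v), mul_comm]

/-- **Homogeneous lifts over the Jacobian ideal.** For forms `F, G, P` of degrees `d, a, p` with `G P ∈ J^F
= (∂_v F)_v` and `m + (d − 1) = a + p`: `G P = Σ_v Q_v ∂_v F` with every `Q_v` a form of degree `m`.
[folklore; cf. [cite: DuqueFrancoVillaflor2025Join, Theorem 2.1]] -/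
theorem exists_isHomogeneous_lift_pderiv [Fintype σ] {F G P : MvPolynomial σ K} {d a p m : ℕ}
    (hF : F.IsHomogeneous d) (hG : G.IsHomogeneous a) (hP : P.IsHomogeneous p) (hm : m + (d - 1) = a + p)
    (hGP : G * P ∈ Ideal.span (Set.range fun v => pderiv v F)) :
    ∃ Q : σ → MvPolynomial σ K, (∀ v, (Q v).IsHomogeneous m) ∧ G * P = ∑ v, Q v * pderiv v F :=
  exists_isHomogeneous_lift (fun _ => hF.pderiv) (hm ▸ hG.mul hP) hGP

/-! ## Homogeneity of Maclean's form -/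

/-- A form of degree `0` is a constant, so its partial derivatives vanish. [folklore] -/
private theorem pderiv_eq_zero_of_isHomogeneous_zero {φ : MvPolynomial σ K} (h : φ.IsHomogeneous 0)
    (v : σ) : pderiv v φ = 0 := by
  rw [totalDegree_eq_zero_iff_eq_C.mp (Nat.le_zero.mp h.totalDegree_le), pderiv_C]

/-- The product `H · ∂_v Q` of forms of degrees `b` and `m` is a form of degree `c` whenever `b + m = c + 1`
(for `m = 0` it vanishes). [folklore] -/
private theorem isHomogeneous_mul_pderiv {H Q : MvPolynomial σ K} {b m c : ℕ} (hH : H.IsHomogeneous b)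
    (hQ : Q.IsHomogeneous m) (h : b + m = c + 1) (v : σ) : (H * pderiv v Q).IsHomogeneous c := by
  rcases Nat.eq_zero_or_pos m with rfl | hm
  · rw [pderiv_eq_zero_of_isHomogeneous_zero hQ, mul_zero]
    exact isHomogeneous_zero σ K c
  · have := hH.mul (hQ.pderiv (i := v))
    rwa [show b + (m - 1) = c by omega] at this

/-- **Maclean's form is homogeneous.** For forms `G, H` of degrees `a, b` and homogeneous lifts `Q_v, R_v` of
degrees `m, m'` with `b + m = c + 1 = m' + a`, `q(G,H) = Σ_v (H ∂_v Q_v − R_v ∂_v G)` is a form of degree `c`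
— for any such lifts. [cite: DuqueFrancoVillaflor2025Join, Theorem 2.1] -/
theorem isHomogeneous_macleanForm [Fintype σ] {G H : MvPolynomial σ K} {Q R : σ → MvPolynomial σ K}
    {a b m m' c : ℕ} (hG : G.IsHomogeneous a) (hH : H.IsHomogeneous b) (hQ : ∀ v, (Q v).IsHomogeneous m)
    (hR : ∀ v, (R v).IsHomogeneous m') (h₁ : b + m = c + 1) (h₂ : m' + a = c + 1) :
    (macleanForm G H Q R).IsHomogeneous c := by
  unfold macleanForm
  exact IsHomogeneous.sum _ _ _ fun v _ =>
    (isHomogeneous_mul_pderiv hH (hQ v) h₁ v).sub (isHomogeneous_mul_pderiv (hR v) hG h₂ v)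

/-- **Duque Franco–Villaflor, Theorem 2.1 (Maclean) — the degree of `q(G,H)`.** For forms `F, P` of degrees
`d, p` and `G, H ∈ (J^F : P)` forms of the same degree `e`, with `m + (d − 1) = e + p`: there are homogeneous
lifts `G P = Σ_v Q_v ∂_v F`, `H P = Σ_v R_v ∂_v F` of degree `m`, and `q(G,H)` is a form of degree
`e + m − 1`. For `e = d` (the tangent space `J^{F,λ}_d`): `m = p + 1` and the degree is `d + p`, the printed
"degree `r := d + (d−2)(n/2+1)` piece" (`p = deg P_λ = (d−2)(n/2+1)`); its class in `(R^F/⟨P_λ⟩)_r` does not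
depend on the lifts (`JoinQuadraticFundamentalForm.lean`). [cite: DuqueFrancoVillaflor2025Join, Theorem 2.1] -/
theorem exists_lifts_isHomogeneous_macleanForm [Fintype σ] {F P G H : MvPolynomial σ K} {d p e m : ℕ}
    (hF : F.IsHomogeneous d) (hP : P.IsHomogeneous p) (hG : G.IsHomogeneous e) (hH : H.IsHomogeneous e)
    (hm : m + (d - 1) = e + p) (hGP : G * P ∈ Ideal.span (Set.range fun v => pderiv v F))
    (hHP : H * P ∈ Ideal.span (Set.range fun v => pderiv v F)) :
    ∃ Q R : σ → MvPolynomial σ K, (∀ v, (Q v).IsHomogeneous m) ∧ (∀ v, (R v).IsHomogeneous m) ∧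
      G * P = ∑ v, Q v * pderiv v F ∧ H * P = ∑ v, R v * pderiv v F ∧
      (macleanForm G H Q R).IsHomogeneous (e + m - 1) := by
  obtain ⟨Q, hQ, hGP'⟩ := exists_isHomogeneous_lift_pderiv hF hG hP hm hGP
  obtain ⟨R, hR, hHP'⟩ := exists_isHomogeneous_lift_pderiv hF hH hP hm hHP
  refine ⟨Q, R, hQ, hR, hGP', hHP', ?_⟩
  rcases Nat.eq_zero_or_pos (e + m) with h0 | hpos
  · -- `e = m = 0`: everything is constant and `q(G,H) = 0`
    have he : e = 0 := by omega
    have hm0 : m = 0 := by omega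
    subst he hm0
    have hq : macleanForm G H Q R = 0 := by
      unfold macleanForm
      exact Finset.sum_eq_zero fun v _ => by
        rw [pderiv_eq_zero_of_isHomogeneous_zero (hQ v), pderiv_eq_zero_of_isHomogeneous_zero hG,
          mul_zero, mul_zero, sub_self]
    rw [hq]
    exact isHomogeneous_zero σ K _
  · exact isHomogeneous_macleanForm hG hH hQ hR (by omega) (by omega)

end Literature.AlgebraicGeometry.DuqueFrancoVillaflor2025

end
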